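import Summits.QuantumFields.YangMills.Theses.SmallCircleAnchor

/-!
# PROMOTE package — the EXACT two-leg split of `AdiabaticContinuity` (stmt-QuantumFields-11142)

Planner-ready, SORRY-FREE (continuation lead c1, 2026-08-17). Alternative to the path split (A*, R) of
`PromoteGlue.lean`: split the crux's CONCLUSION leg by leg, keeping its quantifier prefix and anchor
hypothesis verbatim —

* `LegAContinuation` := the crux with conclusion Leg A only (`∀ T' ≥ T, Cl (fun _ => T') (E β) β m`);
* `LegBContinuation` := the crux with conclusion Leg B only (`∀ s ∈ [0, E β], Cl (fun L => L) s β m`).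

Glue `adiabaticContinuity_of_legA_of_legB : LegAContinuation → LegBContinuation → AdiabaticContinuity`
(thresholds by `max`, ONE rate by `min` through the rate-monotonicity of `Cl`), and EXACTNESS
`legA_of_adiabaticContinuity`, `legB_of_adiabaticContinuity` (the crux implies each child), so
`AdiabaticContinuity ↔ LegAContinuation ∧ LegBContinuation`: each child is WEAKER than the crux (the path
split's A*/R are not implied by the crux). Statements are generated from the route decl's text by replacing
the final conjunction; `lean check`: rc 0, sorries 0, standard axioms.
-/

namespace Summit.QuantumFields.YangMills.Cruxes.AdiabaticContinuity.Birth.PromoteExact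

open scoped BigOperators Topology Manifold Classical MeasureTheory ProbabilityTheory Matrix InnerProductSpace ComplexConjugate ContinuousMap
open Filter Set Function TopologicalSpace MeasureTheory

/-- **Leg A of the crux alone**: the route decl `AdiabaticContinuity` with its conclusion cut to Leg A
(temporal decompactification at full deformation: every `T' ≥ T`, `T'`-pointwise constants). -/
def LegAContinuation : Prop :=
  ∀ (G : Type) [Group G] [TopologicalSpace G] [IsTopologicalGroup G] [CompactSpace G], Literature.MathematicalPhysics.QuantumFieldTheory.IsCompactSimpleLieGroup G → letI : MeasurableSpace G := borel G; haveI : BorelSpace G := ⟨rfl⟩; ∀ (r : Literature.MathematicalPhysics.QuantumFieldTheory.LatticeRep G) (V : G → ℝ), (Continuous V ∧ (∀ a g : G, V (a * g * a⁻¹) = V g) ∧ ∃ g₀ : G, (∀ g : G, V g₀ ≤ V g) ∧ (∀ g : G, V g = V g₀ → ∃ a : G, g = a * g₀ * a⁻¹) ∧ (∀ a b : G, a * g₀ = g₀ * a → b * g₀ = g₀ * b → a * b = b * a)) → ∀ (T : ℕ) [NeZero T], let Cl := fun (τ : ℕ → ℕ) (s β m : ℝ) => ∀ w : ℕ, ∃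 C : ℝ, ∀ (L : ℕ) [NeZero L] [NeZero (τ L)], let St := ZMod (τ L) × (Fin 3 → ZMod L); let Cfg := St × Option (Fin 3) → G; let ν : MeasureTheory.Measure Cfg := MeasureTheory.Measure.pi fun _ => Literature.MathematicalPhysics.QuantumFieldTheory.haarProbability G; let sh : St → Option (Fin 3) → St := fun x μ => Option.elim μ (x.1 + 1, x.2) fun i => (x.1, x.2 + Pi.single i 1); let pl : Cfg → St → Option (Fin 3) → Option (Fin 3) → G := fun U x μ κ => U (x, μ) * U (sh x μ, κ) * (U (sh x κ, μ))⁻¹ * (U (x, κ))⁻¹; let act : Cfg → ℝ := fun U => β * ∑ x : St, ∑ i : Fin 3, (r.ρ (pl U x none (some i))).trace.re + β * ∑ x : St, ∑ q : {q : Fin 3 × Fin 3 // q.1 < q.2}, (r.ρ (pl U x (some q.1.1) (some q.1.2))).trace.re; let P : Cfg → (Fin 3 → ZMod L) → G := fun U x => (List.ofFn fun t : Fin (τ L) => U ((((t : ℕ) : ZMod (τ L)), x), none)).prod; let wgt : Cfg → ℝ := fun U => Real.exp (act U - s * ∑ x : Fin 3 → ZMod L, V (P U x)); let Ex : (Cfg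 → ℝ) → ℝ := fun F => (∫ U, F U * wgt U ∂ν) / (∫ U, wgt U ∂ν); let σ : ℕ → Cfg → Cfg := fun n U p => U ((p.1.1, p.1.2 + Pi.single 0 (n : ZMod L)), p.2); ∀ (c : Fin 3 → ZMod L), let Loc := fun F : Cfg → ℝ => Measurable F ∧ (∀ U, |F U| ≤ 1) ∧ ∀ U U', (∀ p, (∀ i : Fin 3, (p.1.2 i - c i).val ≤ w) → U p = U' p) → F U = F U'; ∀ F₁ F₂ : Cfg → ℝ, Loc F₁ → Loc F₂ → ∀ n : ℕ, 2 * n < L → |Ex (fun U => F₁ U * F₂ (σ n U)) - Ex F₁ * Ex (fun U => F₂ (σ n U))| ≤ C * Real.exp (-(m * n)); ∃ ε₁ : ℝ, ∀ E : ℝ → ℝ, (∀ β : ℝ, ε₁ ≤ E β) → ∀ β₀ : ℝ, (∀ β : ℝ, β₀ ≤ β → ∃ m : ℝ, 0 < m ∧ ∀ w : ℕ, ∃ C : ℝ, ∀ (L : ℕ) [NeZero L], let St := ZMod T × (Fin 3 → ZMod L); let Cfg := St × Option (Fin 3) → G; let ν : MeasureTheory.Measure Cfg := MeasureTheory.Measure.pi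 fun _ => Literature.MathematicalPhysics.QuantumFieldTheory.haarProbability G; let sh : St → Option (Fin 3) → St := fun x μ => Option.elim μ (x.1 + 1, x.2) fun i => (x.1, x.2 + Pi.single i 1); let pl : Cfg → St → Option (Fin 3) → Option (Fin 3) → G := fun U x μ κ => U (x, μ) * U (sh x μ, κ) * (U (sh x κ, μ))⁻¹ * (U (x, κ))⁻¹; let act : Cfg → ℝ := fun U => β * ∑ x : St, ∑ i : Fin 3, (r.ρ (pl U x none (some i))).trace.re + β * ∑ x : St, ∑ q : {q : Fin 3 × Fin 3 // q.1 < q.2}, (r.ρ (pl U x (some q.1.1) (some q.1.2))).trace.re; let P : Cfg → (Fin 3 → ZMod L) → G := fun U x => (List.ofFn fun t : Fin T => U ((((t : ℕ) : ZMod T), x), none)).prod; let wgt : Cfg → ℝ := fun U => Real.exp (act U - E β * ∑ x : Fin 3 → ZMod L, V (P U x)); let Ex : (Cfg → ℝ) → ℝ := fun F => (∫ U, F U * wgt U ∂ν) / (∫ U, wgt U ∂ν); let σ : ℕ → Cfg → Cfg := fun n U p => U ((p.1.1, p.1.2 + Pi.single 0 (n : ZMod L)), p.2); ∀ (c : Fin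 3 → ZMod L), let Loc := fun F : Cfg → ℝ => Measurable F ∧ (∀ U, |F U| ≤ 1) ∧ ∀ U U', (∀ p, (∀ i : Fin 3, (p.1.2 i - c i).val ≤ w) → U p = U' p) → F U = F U'; ∀ F₁ F₂ : Cfg → ℝ, Loc F₁ → Loc F₂ → ∀ n : ℕ, 2 * n < L → |Ex (fun U => F₁ U * F₂ (σ n U)) - Ex F₁ * Ex (fun U => F₂ (σ n U))| ≤ C * Real.exp (-(m * n))) → ∃ β₁ : ℝ, ∀ β : ℝ, β₁ ≤ β → ∃ m : ℝ, 0 < m ∧ ∀ (T' : ℕ) [NeZero T'], T ≤ T' → Cl (fun _ => T') (E β) β m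

/-- **Leg B of the crux alone**: the route decl `AdiabaticContinuity` with its conclusion cut to Leg B
(deformation removal on the symmetric torus: every `s ∈ [0, E β]`), from the SAME anchor hypothesis. -/
def LegBContinuation : Prop :=
  ∀ (G : Type) [Group G] [TopologicalSpace G] [IsTopologicalGroup G] [CompactSpace G], Literature.MathematicalPhysics.QuantumFieldTheory.IsCompactSimpleLieGroup G → letI : MeasurableSpace G := borel G; haveI : BorelSpace G := ⟨rfl⟩; ∀ (r : Literature.MathematicalPhysics.QuantumFieldTheory.LatticeRep G) (V : G → ℝ), (Continuous V ∧ (∀ a g : G, V (a * g * a⁻¹) = V g) ∧ ∃ g₀ : G, (∀ g : G, V g₀ ≤ V g) ∧ (∀ g : G, V g = V g₀ → ∃ a : G, g = a * g₀ * a⁻¹) ∧ (∀ a b : G, a * g₀ = g₀ * a → b * g₀ = g₀ * b → a * b = b * a)) → ∀ (T : ℕ) [NeZero T], let Cl := fun (τ : ℕ → ℕ) (s β m : ℝ) => ∀ w : ℕ, ∃ C : ℝ, ∀ (L : ℕ) [NeZero L] [NeZero (τ L)], let St := ZMod (τ L) × (Fin 3 → ZMod L); let Cfg := St × Option (Fin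 3) → G; let ν : MeasureTheory.Measure Cfg := MeasureTheory.Measure.pi fun _ => Literature.MathematicalPhysics.QuantumFieldTheory.haarProbability G; let sh : St → Option (Fin 3) → St := fun x μ => Option.elim μ (x.1 + 1, x.2) fun i => (x.1, x.2 + Pi.single i 1); let pl : Cfg → St → Option (Fin 3) → Option (Fin 3) → G := fun U x μ κ => U (x, μ) * U (sh x μ, κ) * (U (sh x κ, μ))⁻¹ * (U (x, κ))⁻¹; let act : Cfg → ℝ := fun U => β * ∑ x : St, ∑ i : Fin 3, (r.ρ (pl U x none (some i))).trace.re + β * ∑ x : St, ∑ q : {q : Fin 3 × Fin 3 // q.1 < q.2}, (r.ρ (pl U x (some q.1.1) (some q.1.2))).trace.re; let P : Cfg → (Fin 3 → ZMod L) → G := fun U x => (List.ofFn fun t : Fin (τ L) => U ((((t : ℕ) : ZMod (τ L)), x), none)).prod; let wgt : Cfg → ℝ := fun U => Real.exp (act U - s * ∑ x : Fin 3 → ZMod L, V (P U x)); let Ex : (Cfg → ℝ) → ℝ := fun F => (∫ U, F U * wgt U ∂ν) / (∫ U, wgt U ∂ν); let σ : ℕ → Cfg → Cfg := fun n U p =>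 U ((p.1.1, p.1.2 + Pi.single 0 (n : ZMod L)), p.2); ∀ (c : Fin 3 → ZMod L), let Loc := fun F : Cfg → ℝ => Measurable F ∧ (∀ U, |F U| ≤ 1) ∧ ∀ U U', (∀ p, (∀ i : Fin 3, (p.1.2 i - c i).val ≤ w) → U p = U' p) → F U = F U'; ∀ F₁ F₂ : Cfg → ℝ, Loc F₁ → Loc F₂ → ∀ n : ℕ, 2 * n < L → |Ex (fun U => F₁ U * F₂ (σ n U)) - Ex F₁ * Ex (fun U => F₂ (σ n U))| ≤ C * Real.exp (-(m * n)); ∃ ε₁ : ℝ, ∀ E : ℝ → ℝ, (∀ β : ℝ, ε₁ ≤ E β) → ∀ β₀ : ℝ, (∀ β : ℝ, β₀ ≤ β → ∃ m : ℝ, 0 < m ∧ ∀ w : ℕ, ∃ C : ℝ, ∀ (L : ℕ) [NeZero L], let St := ZMod T × (Fin 3 → ZMod L); let Cfg := St × Option (Fin 3) → G; let ν : MeasureTheory.Measure Cfg := MeasureTheory.Measure.pi fun _ => Literature.MathematicalPhysics.QuantumFieldTheory.haarProbability G; let sh : St → Option (Fin 3) → St := fun x μ => Option.elim μ (x.1 +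 1, x.2) fun i => (x.1, x.2 + Pi.single i 1); let pl : Cfg → St → Option (Fin 3) → Option (Fin 3) → G := fun U x μ κ => U (x, μ) * U (sh x μ, κ) * (U (sh x κ, μ))⁻¹ * (U (x, κ))⁻¹; let act : Cfg → ℝ := fun U => β * ∑ x : St, ∑ i : Fin 3, (r.ρ (pl U x none (some i))).trace.re + β * ∑ x : St, ∑ q : {q : Fin 3 × Fin 3 // q.1 < q.2}, (r.ρ (pl U x (some q.1.1) (some q.1.2))).trace.re; let P : Cfg → (Fin 3 → ZMod L) → G := fun U x => (List.ofFn fun t : Fin T => U ((((t : ℕ) : ZMod T), x), none)).prod; let wgt : Cfg → ℝ := fun U => Real.exp (act U - E β * ∑ x : Fin 3 → ZMod L, V (P U x)); let Ex : (Cfg → ℝ) → ℝ := fun F => (∫ U, F U * wgt U ∂ν) / (∫ U, wgt U ∂ν); let σ : ℕ → Cfg → Cfg := fun n U p => U ((p.1.1, p.1.2 + Pi.single 0 (n : ZMod L)), p.2); ∀ (c : Fin 3 → ZMod L), let Loc := fun F : Cfg → ℝ => Measurable F ∧ (∀ U, |F U| ≤ 1) ∧ ∀ U U', (∀ p, (∀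 i : Fin 3, (p.1.2 i - c i).val ≤ w) → U p = U' p) → F U = F U'; ∀ F₁ F₂ : Cfg → ℝ, Loc F₁ → Loc F₂ → ∀ n : ℕ, 2 * n < L → |Ex (fun U => F₁ U * F₂ (σ n U)) - Ex F₁ * Ex (fun U => F₂ (σ n U))| ≤ C * Real.exp (-(m * n))) → ∃ β₁ : ℝ, ∀ β : ℝ, β₁ ≤ β → ∃ m : ℝ, 0 < m ∧ ∀ s : ℝ, 0 ≤ s → s ≤ E β → Cl (fun L => L) s β m

/-- Exactness, leg A: the crux implies `LegAContinuation` (drop the second conjunct). [folklore] -/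
theorem legA_of_adiabaticContinuity
    (h : Summit.QuantumFields.YangMills.Theses.SmallCircleAnchor.AdiabaticContinuity) : LegAContinuation := by
  intro G _ _ _ _ hG r V hV T _ Cl
  obtain ⟨ε₁, hε⟩ := h G hG r V hV T
  refine ⟨ε₁, fun E hE β₀ hanch => ?_⟩
  obtain ⟨β₁, hβ₁⟩ := hε E hE β₀ hanch
  refine ⟨β₁, fun β hβ => ?_⟩
  obtain ⟨m, hm, hA, -⟩ := hβ₁ β hβ
  exact ⟨m, hm, hA⟩

/-- Exactness, leg B: the crux implies `LegBContinuation` (drop the first conjunct). [folklore] -/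
theorem legB_of_adiabaticContinuity
    (h : Summit.QuantumFields.YangMills.Theses.SmallCircleAnchor.AdiabaticContinuity) : LegBContinuation := by
  intro G _ _ _ _ hG r V hV T _ Cl
  obtain ⟨ε₁, hε⟩ := h G hG r V hV T
  refine ⟨ε₁, fun E hE β₀ hanch => ?_⟩
  obtain ⟨β₁, hβ₁⟩ := hε E hE β₀ hanch
  refine ⟨β₁, fun β hβ => ?_⟩
  obtain ⟨m, hm, -, hB⟩ := hβ₁ β hβ
  exact ⟨m, hm, hB⟩

/-- **Glue of the exact split**: Leg A and Leg B (each from the anchor, each with its own threshold and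
rate) give the crux — deformation threshold `max ε₁ᴬ ε₁ᴮ`, coupling threshold `max β₁ᴬ β₁ᴮ`, the ONE
rate `min mᴬ mᴮ` through the rate-monotonicity of the clustering predicate `Cl`. [folklore] -/
theorem adiabaticContinuity_of_legA_of_legB (hA : LegAContinuation) (hB : LegBContinuation) :
    Summit.QuantumFields.YangMills.Theses.SmallCircleAnchor.AdiabaticContinuity := by
  intro G _ _ _ _ hG r V hV T _ Cl
  -- rate monotonicity of the local clustering predicate `Cl τ s β ·`
  have hmono : ∀ (τ : ℕ → ℕ) (s β m m' : ℝ), m ≤ m' → Cl τ s β m' → Cl τ s β m := by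
    intro τ s β m m' hmm h w
    obtain ⟨C, hC⟩ := h w
    refine ⟨max C 0, fun L _ _ => ?_⟩
    intro St Cfg ν sh pl act P wgt Ex σ c Loc F₁ F₂ hF₁ hF₂ n hn
    have key := hC L c F₁ F₂ hF₁ hF₂ n hn
    refine key.trans ?_
    calc C * Real.exp (-(m' * n)) ≤ max C 0 * Real.exp (-(m' * n)) :=
          mul_le_mul_of_nonneg_right (le_max_left _ _) (Real.exp_pos _).le
      _ ≤ max C 0 * Real.exp (-(m * n)) := by
          refine mul_le_mul_of_nonneg_left (Real.exp_le_exp.mpr ?_) (le_max_right _ _)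
          have : m * (n : ℝ) ≤ m' * n := mul_le_mul_of_nonneg_right hmm (Nat.cast_nonneg n)
          linarith
  obtain ⟨εA, hεA⟩ := hA G hG r V hV T
  obtain ⟨εB, hεB⟩ := hB G hG r V hV T
  refine ⟨max εA εB, fun E hE β₀ hanch => ?_⟩
  obtain ⟨βA, hβA⟩ := hεA E (fun β => (le_max_left _ _).trans (hE β)) β₀ hanch
  obtain ⟨βB, hβB⟩ := hεB E (fun β => (le_max_right _ _).trans (hE β)) β₀ hanch
  refine ⟨max βA βB, fun β hβ => ?_⟩
  obtain ⟨mA, hmA, hLegA⟩ := hβA β ((le_max_left _ _).trans hβ)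
  obtain ⟨mB, hmB, hLegB⟩ := hβB β ((le_max_right _ _).trans hβ)
  refine ⟨min mA mB, lt_min hmA hmB, ?_, ?_⟩
  · intro T' _ hT'
    exact hmono (fun _ => T') (E β) β (min mA mB) mA (min_le_left _ _) (hLegA T' hT')
  · intro s hs0 hs1
    exact hmono (fun L => L) s β (min mA mB) mB (min_le_right _ _) (hLegB s hs0 hs1)

end Summit.QuantumFields.YangMills.Cruxes.AdiabaticContinuity.Birth.PromoteExact
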